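import Mathlib
import Literature.MathematicalPhysics.QuantumLattice.FermiRG.Salmhofer1998Sec6
import Literature.MathematicalPhysics.QuantumLattice.FermiRG.Salmhofer1998Sec5PropagatorLemmas
import HarnessLib

/-!
# Salmhofer 1998 §6: the many-fermion propagator meets the hypotheses of Theorems 3–7 (bridge lemmas)

Theorem-only companion of F7e `Salmhofer1998Sec6.lean` (gate-hubbard-kl wave, t7 g8).  The theorems of §6 are
typed there for an abstract scale family `(C, Ċ)` under the displays their printed proofs invoke
(`LoopBoundsHold` = (6.8)/(6.9), `VanishesBeyond` = Lemma 4's vanishing beyond `log(βε₀/π)`).  This file checks,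
in the kernel, that for the many-fermion propagator (5.17) (`modelProp`/`modelPropDot`) these hypothesis SHAPES are
exactly supplied by Lemma 7 (`OverlappingLoopBound`, given as a hypothesis — it is a named fact) and by Lemma 4's
vanishing statement (PROVED in the tree: `cutoffCovInf_eq_zero_of_log_lt`, t7 g4), i.e. that the Lemma-7 →
Theorem-6 interface of the typed file coheres.  Source: M. Salmhofer, Commun. Math. Phys. **194** (1998) 249–295,
arXiv:cond-mat/9706188 [Salmhofer1998]; locators as in F7e.  No definitions, no named facts; nothing about the
Hubbard model is asserted.
-/

noncomputable section

open MeasureTheory Filter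
open scoped Topology ENNReal

namespace Literature.MathematicalPhysics.QuantumLattice.FermiRG

namespace Salmhofer1998

variable {d : ℕ}

/-- `ω_β` fixes the Matsubara frequencies: `ω_β(ω_n) = ω_n` ((5.13) with `p₀ = ω_n ∈ (2πn/β, 2π(n+1)/β]`).
[cite: Salmhofer1998, §5.4 (5.13) (p.19 L93–98)] -/
theorem omegaStep_matsFreq {β : ℝ} (hβ : 0 < β) (n : ℤ) : omegaStep β (matsFreq β n) = matsFreq β n := by
  have hπ := Real.pi_pos
  apply omegaStep_eq hβ
  · have : matsFreq β n = (2 * Real.pi * n + Real.pi) / β := by unfold matsFreq; ring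
    rw [this, div_lt_div_iff_of_pos_right hβ]
    linarith
  · have : matsFreq β n = (2 * Real.pi * n + Real.pi) / β := by unfold matsFreq; ring
    rw [this, div_le_div_iff_of_pos_right hβ]
    linarith

/-- At a Matsubara frequency the direct-frequency propagator IS the thermodynamic-limit propagator `D̂_t`.
[cite: Salmhofer1998, §5.4 (5.17) (p.19 L118–126)] -/
theorem modelProp_matsFreq (M : ModelData d) (χ₁ : ℝ → ℝ) {β : ℝ} (hβ : 0 < β) (t : ℝ) (n : ℤ)
    (p : Mom d) : modelProp M χ₁ t (matsFreq β n, p) = cutoffCovInf M χ₁ β t (matsFreq β n) p := by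
  simp [modelProp, cutoffCovInf, omegaStep_matsFreq hβ]

/-- **Lemma 4's vanishing statement in the shape `VanishesBeyond`** (p.19 L133–135: "If `t > log(βε₀/π)`, then
`Ĉ_t(p) = 0`"; hence also `Ċ_t = ∂_t Ĉ_t = 0` there, the condition being open in `t`): the many-fermion scale
family `(modelProp, modelPropDot)` vanishes on `𝕄(β)` beyond `log(βε₀/π)`.  From the tree's
`cutoffCovInf_eq_zero_of_log_lt`. [cite: Salmhofer1998, Lemma 4 (p.19 L133–135)] -/
theorem vanishesBeyond_modelProp (M : ModelData d) (hM : M.Hyp) {χ₁ : ℝ → ℝ} (hχ : IsCutoff χ₁) {β : ℝ}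
    (hβ : 0 < β) : VanishesBeyond β M.eps0 (modelProp M χ₁) (modelPropDot M χ₁) := by
  intro t ht n p
  have h0 := hM.eps0_pos
  have hC : ∀ s : ℝ, Real.log (β * M.eps0 / Real.pi) < s → modelProp M χ₁ s (matsFreq β n, p) = 0 := by
    intro s hs
    rw [modelProp_matsFreq M χ₁ hβ]
    exact cutoffCovInf_eq_zero_of_log_lt M hχ h0 hβ hs _ p
  refine ⟨hC t ht, ?_⟩
  -- `Ċ_t = ∂_t 𝒞_t(ω_n, E(𝐩))` and `s ↦ 𝒞_s(ω_n, E(𝐩))` vanishes on the open set `{s > log(βε₀/π)} ∋ t`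
  have hev : (fun s : ℝ => covC χ₁ M.eps0 s (matsFreq β n) (M.E p)) =ᶠ[𝓝 t] fun _ => (0 : ℂ) := by
    filter_upwards [Ioi_mem_nhds ht] with s hs
    exact hC s hs
  show covCDot χ₁ M.eps0 t (matsFreq β n) (M.E p) = 0
  unfold covCDot
  rw [hev.deriv_eq, deriv_const]

/-- **The Lemma-7 → Theorem-6 interface.**  If Lemma 7 holds (`OverlappingLoopBound`, named fact F-091) then,
for every model of the §2.3 class in `d ≥ 2` with `k₀ > d`, every cutoff `χ₁`, all constants `B_α ≥ 0`, `J₁ > 0`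
validating (5.18) (at every real frequency) and (5.21), and every uniform bound `B ≥ B_α` (`|α| ≤ 2`; print:
`B = max_α B_α`, p.24 L115), there is a `β`-independent `K₀ > 0` such that the many-fermion scale family
`(modelProp, modelPropDot)` satisfies `LoopBoundsHold` — the hypothesis of Theorems 3–7 in F7e — for every `β` in
the window `βε₀ ≥ 6`. [cite: Salmhofer1998, Lemma 7 (p.22 L117–131) and Theorem 6 (p.24 L99–123)] -/
theorem loopBoundsHold_modelProp_of_overlappingLoopBound (h7 : OverlappingLoopBound) (M : ModelData d)
    (hd : 2 ≤ d) (hM : M.Hyp) (hk : d < M.k0) {χ₁ : ℝ → ℝ} (hχ : IsCutoff χ₁) (B : (Fin d → ℕ) → ℝ)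
    (J₁ Bmax : ℝ) (hB : ∀ α, 0 ≤ B α) (hJ : 0 < J₁) (hBmax : ∀ α : Fin d → ℕ, miDeg α ≤ 2 → B α ≤ Bmax)
    (h518 : ∀ β : ℝ, 0 < β → 6 ≤ β * M.eps0 → ∀ t : ℝ, 0 ≤ t → ∀ α : Fin d → ℕ, miDeg α ≤ M.k0 →
      ∀ (x : ℝ) (p : Mom d),
        ‖multiMomPartial α (modelPropDot M χ₁ t) (x, p)‖ ≤
          B α * (epsT M.eps0 t)⁻¹ ^ (1 + miDeg α) *
            (if |x| ≤ epsT M.eps0 t then 1 else 0) * (if |M.E p| ≤ epsT M.eps0 t then 1 else 0))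
    (h521 : ∀ β : ℝ, 0 < β → 6 ≤ β * M.eps0 → ∀ t : ℝ, 0 ≤ t → Display521 M χ₁ β J₁ t) :
    ∃ K₀ : ℝ, 0 < K₀ ∧ ∀ β : ℝ, 0 < β → 6 ≤ β * M.eps0 →
      LoopBoundsHold M.latt β M.eps0 (modelProp M χ₁) (modelPropDot M χ₁) Bmax K₀ J₁ := by
  obtain ⟨-, h68, K₀, hK₀, h69⟩ := h7 d M hd hM hk χ₁ hχ B J₁ hB hJ h518 h521
  have hk2 : 2 ≤ M.k0 := hM.two_le_k0
  refine ⟨K₀, hK₀, fun β hβ hβε => ⟨?_, ?_⟩⟩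
  · intro t ht α hα i hi
    have hε := epsT_pos hM.eps0_pos t
    refine (h68 β hβ hβε t ht α (hα.trans hk2) i hi).trans (ENNReal.ofReal_le_ofReal ?_)
    have h1 : 0 ≤ (8 * J₁) ^ (i - 1) := by positivity
    have h2 : 0 < epsT M.eps0 t ^ ((i : ℤ) - 2 - (miDeg α : ℤ)) := zpow_pos hε _
    calc (8 * J₁) ^ (i - 1) * B α * epsT M.eps0 t ^ ((i : ℤ) - 2 - (miDeg α : ℤ))
        = (8 * J₁) ^ (i - 1) * epsT M.eps0 t ^ ((i : ℤ) - 2 - (miDeg α : ℤ)) * B α := by ring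
      _ ≤ (8 * J₁) ^ (i - 1) * epsT M.eps0 t ^ ((i : ℤ) - 2 - (miDeg α : ℤ)) * Bmax :=
          mul_le_mul_of_nonneg_left (hBmax α hα) (mul_nonneg h1 h2.le)
      _ = (8 * J₁) ^ (i - 1) * Bmax * epsT M.eps0 t ^ ((i : ℤ) - 2 - (miDeg α : ℤ)) := by ring
  · intro t ht α hα i hi
    have hε := epsT_pos hM.eps0_pos t
    refine (h69 β hβ hβε t ht α (hα.trans hk2) i hi).trans (ENNReal.ofReal_le_ofReal ?_)
    have h1 : 0 ≤ (8 * J₁) ^ (i - 1) := by positivity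
    have h2 : 0 < epsT M.eps0 t ^ ((i : ℤ) - 1 - (miDeg α : ℤ)) := zpow_pos hε _
    have h3 : 0 ≤ twoLoopFactor d t := by
      unfold twoLoopFactor; split_ifs <;> positivity
    calc (8 * J₁) ^ (i - 1) * B α * K₀ * twoLoopFactor d t * epsT M.eps0 t ^ ((i : ℤ) - 1 - (miDeg α : ℤ))
        = ((8 * J₁) ^ (i - 1) * K₀ * twoLoopFactor d t *
            epsT M.eps0 t ^ ((i : ℤ) - 1 - (miDeg α : ℤ))) * B α := by ring
      _ ≤ ((8 * J₁) ^ (i - 1) * K₀ * twoLoopFactor d t *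
            epsT M.eps0 t ^ ((i : ℤ) - 1 - (miDeg α : ℤ))) * Bmax :=
          mul_le_mul_of_nonneg_left (hBmax α hα) (by positivity)
      _ = (8 * J₁) ^ (i - 1) * Bmax * K₀ * twoLoopFactor d t *
            epsT M.eps0 t ^ ((i : ℤ) - 1 - (miDeg α : ℤ)) := by ring

end Salmhofer1998

end Literature.MathematicalPhysics.QuantumLattice.FermiRG
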